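import Summits.HodgeConjecture.HodgeConjecture.Theorems.Ring2HypothesesDescentMotivatedCorrespondenceAlgebra
import Summits.HodgeConjecture.HodgeConjecture.Theorems.Ring2AbelianAllAndreLiebermanCorrespondenceAlgebra
import Literature.AlgebraicGeometry.HodgeTheory.CorrespondenceComposition
import Literature.AlgebraicGeometry.HodgeTheory.GysinBaseChange
import Literature.AlgebraicGeometry.HodgeTheory.ComplexGysinCorrespondence
import HarnessLib

/-!
# Ring 2 hypotheses, descent face — the algebra of operators induced by MOTIVATED correspondences
# (André 1996, §2.1 Déf. 2 and Corollaire): composition, Lefschetz twists on both sides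

research route conditional on HC_CM; not a corollary; Q11.4-sentence-2 already refuted in dim ≥ 3.
Cell `pub-hodge-ring2` (Hodge ladder STAGE 3), seat `ring2-b05` (binder row b05
`Ring2.Hypotheses.MotivatedImpliesAlgebraicAV`), gen 36. `HC_CM` (`Theses.RankFourFaces.CMAbelianHodge`) does
not occur in this file; nothing here proves a case of the Hodge conjecture; the row b05 stays OPEN.

André 1996, §2.1 Déf. 2 (p. 15): «`C_mot(X, Y) = A_mot(X × Y)` … correspondances motivées» and Corollaire (p. 15):
«Les correspondances motivées se composent». This file is the MOTIVATED twin of ab-andre-2's part XXII-b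
(`Ring2AbelianAllAndreLiebermanCorrespondenceAlgebra`, the same algebra for ALGEBRAIC correspondences), for the tree's
constructed action `corrAction μ hW hX hab γ = pr_{W*}(pr_X^*(·) ∪ γ)` (`HodgeTheory/ComplexGysinCorrespondence`, any
orientation family `μ`). The set of operators `Hᵃ(X(ℂ); ℂ) → Hᵇ(W(ℂ); ℂ)` induced by motivated classes of
codimension `e` is written WITHOUT a new definition as the image submodule
`(motivatedClasses (m + n) (W ⊗ X) e).map (corrAction μ hW hX hab)` of `Hᵃ →ₗ Hᵇ`; it is a `ℂ`-subspace, so sums,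
differences and scalar multiples of such operators are such operators for free.

* §1 `comp_mem_map_corrAction_motivatedClasses` — **composition** (Fulton Def. 16.1.1 / André Corollaire): the tree's
  `corr_comp_of_baseChange` with Gysin base change `gysin_baseChange` (a tree theorem) and this seat's
  `corrCompClass_mem_motivatedClasses` (gen 35: the composite class `p₁₃_*(p₁₂^*γ ∪ p₂₃^*γ')` is motivated).
* §2 **Lefschetz twists**: for `η ∈ N¹ H²` algebraic, `[γ]_* ∘ L_η = [pr_X^* η ∪ γ]_*`
  (`comp_lefschetzOperator_mem_…`, `comp_lefschetzPowTo_mem_…`) and `L_η ∘ [γ]_* = [pr_W^* η ∪ γ]_*`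
  (`lefschetzOperator_comp_mem_…`, `lefschetzPowTo_comp_mem_…`, projection formula `complexGysin_cup`); an algebraic
  class times a motivated class is motivated (Prop. 2.1 (i), `cupProduct_mem_motivatedClasses_of_algebraic_left`).
* §3 `corrAction_mem_map_corrAction_motivatedClasses`, `mem_map_corrAction_motivatedClasses_of_eq` — bookkeeping.

No definition, no named fact, no sorry. References: Andre1996Motifs (§2.1 Déf. 2, Corollaire p. 15),
Fulton1998 (§16.1 Def. 16.1.1, Prop. 16.1.1; Prop. 1.7), Buskin2019 (Lemma 6.3), VoisinHodgeII2003 (§9.2.4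
Prop. 9.20, proof of Thm. 10.17 (10.7)), HatcherAT2002 (§3.2 Prop. 3.10, Thm. 3.11), FultonYoungTableaux1997
(App. B (5)–(6)).
-/

noncomputable section

-- every declaration of this problem lives in `Summit.HodgeConjecture.HodgeConjecture.…` (summit = sub-problem)
set_option linter.dupNamespace false

open CategoryTheory AlgebraicGeometry MonoidalCategory CartesianMonoidalCategory
open Literature.AlgebraicTopology.SingularHomology Literature.Geometry.Kaehler
open Literature.AlgebraicGeometry Literature.AlgebraicGeometry.Motives
  Literature.AlgebraicGeometry.HodgeTheory

namespace Summit.HodgeConjecture.HodgeConjecture.Theorems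

variable (μ : OrientationFamily) {l m n : ℕ} {W X Y Z : SchemeOver ℂ}

/-! ## §1 Composition of motivated correspondences -/

/-- **Motivated correspondences compose, operator form** (André 1996, §2.1 Corollaire «les correspondances motivées
se composent»; Fulton Def. 16.1.1 / Prop. 16.1.1): for smooth projective `X, Y, Z` of dimensions `l, m, n` and
operators `T = [γ]_* : H^{a₁}(Y(ℂ)) → H^{a₂}(X(ℂ))`, `T' = [γ']_* : Hᵃ(Z(ℂ)) → H^{a₁}(Y(ℂ))` induced by MOTIVATED
classes `γ ∈ A_motᵉ(X ⊗ Y)_ℂ`, `γ' ∈ A_mot^{e'}(Y ⊗ Z)_ℂ`, the composite `T ∘ T'` is induced by the motivated class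
`c • p₁₃_*(p₁₂^* γ ∪ p₂₃^* γ') ∈ A_mot^{e''}(X ⊗ Z)_ℂ`, `e + e' = e'' + m` (`corr_comp_of_baseChange` + the tree theorem
`gysin_baseChange` + `corrCompClass_mem_motivatedClasses`). [cite: Andre1996Motifs, §2.1 Corollaire (p. 15)]
[cite: Fulton1998, §16.1 Def. 16.1.1 and Prop. 16.1.1] -/
theorem comp_mem_map_corrAction_motivatedClasses (hX : IsSmoothProjective l X) (hY : IsSmoothProjective m Y)
    (hZ : IsSmoothProjective n Z) {e e' e'' a a₁ a₂ : ℕ} (he : e + e' = e'' + m) (h₁ : a + 2 * e' = a₁ + 2 * n)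
    (h₂ : a₁ + 2 * e = a₂ + 2 * m) (h₃ : a + 2 * e'' = a₂ + 2 * n)
    {T : complexBetti Y a₁ →ₗ[ℂ] complexBetti X a₂}
    (hT : T ∈ (motivatedClasses (l + m) (X ⊗ Y) e).map (corrAction μ hX hY h₂))
    {T' : complexBetti Z a →ₗ[ℂ] complexBetti Y a₁}
    (hT' : T' ∈ (motivatedClasses (m + n) (Y ⊗ Z) e').map (corrAction μ hY hZ h₁)) :
    T ∘ₗ T' ∈ (motivatedClasses (l + n) (X ⊗ Z) e'').map (corrAction μ hX hZ h₃) := by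
  obtain ⟨γ, hγ, rfl⟩ := hT
  obtain ⟨γ', hγ', rfl⟩ := hT'
  have hμ : μ.HasPoincareDuality := OrientationFamily.hasPoincareDuality μ
  obtain ⟨c, hc⟩ := gysin_baseChange μ hX hY hZ (k := a + 2 * e') (k₁ := a₁)
    (show a + 2 * e' + 2 * m = a₁ + 2 * (m + n) by omega)
  refine ⟨c • complexGysin μ (IsSmoothProjective.tensor_holds hX (IsSmoothProjective.tensor_holds hY hZ))
      (IsSmoothProjective.tensor_holds hX hZ) (X ◁ snd Y Z)
      (show 2 * (e + e') + 2 * (l + n) = 2 * e'' + 2 * (l + (m + n)) by omega)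
      (cupProduct ((Nat.mul_add 2 e e').symm : 2 * e + 2 * e' = 2 * (e + e'))
        (complexBetti.map (X ◁ fst Y Z) (2 * e) γ) (complexBetti.map (snd X (Y ⊗ Z)) (2 * e') γ')),
    Submodule.smul_mem _ _ (corrCompClass_mem_motivatedClasses μ hX hY hZ he hγ hγ'), ?_⟩
  refine LinearMap.ext fun y ↦ ?_
  rw [LinearMap.comp_apply, corrAction_apply, corrAction_apply, corrAction_apply]
  exact corr_comp_of_baseChange hμ hX hY hZ h₁ h₂ (show 2 * e + 2 * e' = 2 * e'' + 2 * m by omega)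
    ((Nat.mul_add 2 e e').symm) γ γ' c hc y

/-! ## §2 Lefschetz twists on the right and on the left -/

/-- **Right twist by one Lefschetz operator**: for `η ∈ N¹ H²(X(ℂ))` algebraic and `T = [γ]_*` induced by a motivated
`γ ∈ A_motᵉ(W ⊗ X)_ℂ`, `T ∘ L_η = [pr_X^* η ∪ γ]_*` with `pr_X^* η ∪ γ ∈ A_mot^{e+1}(W ⊗ X)_ℂ` (an algebraic class
times a motivated class is motivated, Prop. 2.1 (i)): `pr_{W*}(pr_X^*(η ∪ x) ∪ γ) = pr_{W*}(pr_X^* x ∪ (pr_X^* η ∪ γ))`.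
[cite: Andre1996Motifs, Prop. 2.1 (i) (p. 14) and §2.1 Corollaire (p. 15)]
[cite: VoisinHodgeII2003, proof of Thm. 10.17 (10.7)] [cite: HatcherAT2002, §3.2 Prop. 3.10 and Thm. 3.11] -/
theorem comp_lefschetzOperator_mem_map_corrAction_motivatedClasses (hW : IsSmoothProjective m W)
    (hX : IsSmoothProjective n X) {η : complexBetti X 2} (hη : η ∈ algebraicClasses X 1) {e a₁ a₂ b : ℕ}
    (h12 : 2 + a₁ = a₂) (hab : a₂ + 2 * e = b + 2 * n) (hab₁ : a₁ + 2 * (e + 1) = b + 2 * n)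
    {T : complexBetti X a₂ →ₗ[ℂ] complexBetti W b}
    (hT : T ∈ (motivatedClasses (m + n) (W ⊗ X) e).map (corrAction μ hW hX hab)) :
    T ∘ₗ lefschetzOperator η h12 ∈ (motivatedClasses (m + n) (W ⊗ X) (e + 1)).map (corrAction μ hW hX hab₁) := by
  obtain ⟨γ, hγ, rfl⟩ := hT
  have hWX := IsSmoothProjective.tensor_holds hW hX
  have hηWX : complexBetti.map (snd W X) 2 η ∈ algebraicClasses (W ⊗ X) 1 :=
    map_snd_mem_supportedClasses hW hX (a := 2 * 1) hη
  have hγ₁ : cupProduct (show 2 * 1 + 2 * e = 2 * (e + 1) by omega) (complexBetti.map (snd W X) 2 η) γ ∈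
      motivatedClasses (m + n) (W ⊗ X) (e + 1) :=
    cupProduct_mem_motivatedClasses_of_algebraic_left hWX _ hηWX hγ
  refine ⟨_, hγ₁, LinearMap.ext fun x ↦ ?_⟩
  rw [LinearMap.comp_apply, corrAction_apply, corrAction_apply, lefschetzOperator_apply, complexBetti.map_cupProduct]
  -- `pr_X^* η ∪ pr_X^* x = pr_X^* x ∪ pr_X^* η` (degree `2` is even)
  rw [cupProduct_gradedComm_holds ℂ _ h12 (show a₁ + 2 = a₂ by omega) (complexBetti.map (snd W X) 2 η)
    (complexBetti.map (snd W X) a₁ x)]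
  have heven : ((-1 : ℂ) ^ (2 * a₁)) = 1 := by rw [pow_mul, neg_one_sq, one_pow]
  rw [heven, one_smul,
    cupProduct_assoc (show a₁ + 2 = a₂ by omega) (show 2 * 1 + 2 * e = 2 * (e + 1) by omega) rfl
      (show a₁ + 2 * (e + 1) = a₂ + 2 * e by omega)]
  exact Ring2.AbelianAll.complexGysin_cupProduct_congr μ hWX hW (fst W X) rfl _ _ _ _ _

/-- **Right twist by an iterated Lefschetz operator**: `T ∘ Lʳ_η` is induced by a motivated class of codimension
`e + r` whenever `T : H^{a₂}(X(ℂ)) → Hᵇ(W(ℂ))` is induced by one of codimension `e` (`η` algebraic; induction on `r`,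
peeling off the outermost `L`). [cite: Andre1996Motifs, Prop. 2.1 (i) (p. 14) and §2.1 Corollaire (p. 15)]
[cite: VoisinHodgeII2003, proof of Thm. 10.17 (10.7)] -/
theorem comp_lefschetzPowTo_mem_map_corrAction_motivatedClasses (hW : IsSmoothProjective m W)
    (hX : IsSmoothProjective n X) {η : complexBetti X 2} (hη : η ∈ algebraicClasses X 1) (a₁ : ℕ) :
    ∀ (r : ℕ) {e e' a₂ b : ℕ} (_ : e + r = e') (h12 : a₁ + 2 * r = a₂) (hab : a₂ + 2 * e = b + 2 * n)
      (hab₁ : a₁ + 2 * e' = b + 2 * n) {T : complexBetti X a₂ →ₗ[ℂ] complexBetti W b}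
      (_ : T ∈ (motivatedClasses (m + n) (W ⊗ X) e).map (corrAction μ hW hX hab)),
      T ∘ₗ lefschetzPowTo η r a₁ a₂ h12 ∈ (motivatedClasses (m + n) (W ⊗ X) e').map (corrAction μ hW hX hab₁)
  | 0, e, e', a₂, b, he, h12, hab, hab₁, T, hT => by
    obtain rfl : e = e' := by omega
    obtain rfl : a₁ = a₂ := by omega
    rwa [lefschetzPowTo_zero_eq_id, LinearMap.comp_id]
  | r + 1, e, e', a₂, b, he, h12, hab, hab₁, T, hT => by
    -- `T ∘ L^{r+1} = (T ∘ L) ∘ Lʳ`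
    have hstep := comp_lefschetzOperator_mem_map_corrAction_motivatedClasses μ hW hX hη
      (show 2 + (a₁ + 2 * r) = a₂ by omega) hab (show a₁ + 2 * r + 2 * (e + 1) = b + 2 * n by omega) hT
    have hind := comp_lefschetzPowTo_mem_map_corrAction_motivatedClasses hW hX hη a₁ r
      (show e + 1 + r = e' by omega) rfl (show a₁ + 2 * r + 2 * (e + 1) = b + 2 * n by omega) hab₁ hstep
    have hcomp : (T ∘ₗ lefschetzOperator η (show 2 + (a₁ + 2 * r) = a₂ by omega)) ∘ₗ
        lefschetzPowTo η r a₁ (a₁ + 2 * r) rfl = T ∘ₗ lefschetzPowTo η (r + 1) a₁ a₂ h12 := by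
      refine LinearMap.ext fun x ↦ ?_
      rw [LinearMap.comp_apply, LinearMap.comp_apply, LinearMap.comp_apply,
        lefschetzPowTo_succ_apply η r a₁ (a₁ + 2 * r) a₂ rfl h12 (by omega)]
    rwa [hcomp] at hind

/-- **Left twist by one Lefschetz operator**: for `η ∈ N¹ H²(W(ℂ))` algebraic and `T = [γ]_* : Hᵃ(X(ℂ)) → Hᵇ(W(ℂ))`
induced by a motivated `γ ∈ A_motᵉ(W ⊗ X)_ℂ`, `L_η ∘ T = [pr_W^* η ∪ γ]_*`: the projection formula
`η ∪ pr_{W*}(w) = pr_{W*}(pr_W^* η ∪ w)` (`complexGysin_cup`) and `pr_W^* η ∪ (pr_X^* x ∪ γ) = pr_X^* x ∪ (pr_W^* η ∪ γ)`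
(associativity, graded commutativity in even degree). [cite: Andre1996Motifs, Prop. 2.1 (i) (p. 14) and §2.1 Corollaire (p. 15)]
[cite: FultonYoungTableaux1997, Appendix B §B.1 (5)–(6)] [cite: HatcherAT2002, §3.2 Prop. 3.10 and Thm. 3.11] -/
theorem lefschetzOperator_comp_mem_map_corrAction_motivatedClasses (hW : IsSmoothProjective m W)
    (hX : IsSmoothProjective n X) {η : complexBetti W 2} (hη : η ∈ algebraicClasses W 1) {e a b b₂ : ℕ}
    (h12 : 2 + b = b₂) (hab : a + 2 * e = b + 2 * n) (hab₁ : a + 2 * (e + 1) = b₂ + 2 * n)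
    {T : complexBetti X a →ₗ[ℂ] complexBetti W b}
    (hT : T ∈ (motivatedClasses (m + n) (W ⊗ X) e).map (corrAction μ hW hX hab)) :
    lefschetzOperator η h12 ∘ₗ T ∈ (motivatedClasses (m + n) (W ⊗ X) (e + 1)).map (corrAction μ hW hX hab₁) := by
  obtain ⟨γ, hγ, rfl⟩ := hT
  have hμ : μ.HasPoincareDuality := OrientationFamily.hasPoincareDuality μ
  have hWX := IsSmoothProjective.tensor_holds hW hX
  have hηWX : complexBetti.map (fst W X) 2 η ∈ algebraicClasses (W ⊗ X) 1 :=
    map_fst_mem_supportedClasses hW hX (a := 2 * 1) hη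
  have hγ₁ : cupProduct (show 2 * 1 + 2 * e = 2 * (e + 1) by omega) (complexBetti.map (fst W X) 2 η) γ ∈
      motivatedClasses (m + n) (W ⊗ X) (e + 1) :=
    cupProduct_mem_motivatedClasses_of_algebraic_left hWX _ hηWX hγ
  refine ⟨_, hγ₁, LinearMap.ext fun x ↦ ?_⟩
  rw [LinearMap.comp_apply, corrAction_apply, corrAction_apply, lefschetzOperator_apply]
  -- projection formula: `η ∪ pr_{W*}(w) = pr_{W*}(pr_W^* η ∪ w)`
  rw [← complexGysin_cup hμ hWX hW (fst W X) (show 2 + (a + 2 * e) = a + 2 * (e + 1) by omega)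
    (corrAction_degree m hab₁) (corrAction_degree m hab) h12 η _]
  congr 1
  -- `pr_X^* x ∪ (pr_W^* η ∪ γ) = (pr_X^* x ∪ pr_W^* η) ∪ γ = (pr_W^* η ∪ pr_X^* x) ∪ γ = pr_W^* η ∪ (pr_X^* x ∪ γ)`
  rw [← cupProduct_assoc (show a + 2 * 1 = a + 2 by omega) (show 2 * 1 + 2 * e = 2 * (e + 1) by omega)
      (show a + 2 + 2 * e = a + 2 * (e + 1) by omega) rfl,
    cupProduct_gradedComm_holds ℂ _ (show a + 2 * 1 = a + 2 by omega) (show 2 * 1 + a = a + 2 by omega)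
      (complexBetti.map (snd W X) a x) (complexBetti.map (fst W X) 2 η),
    Even.neg_one_pow ⟨a, by ring⟩, one_smul,
    cupProduct_assoc (show 2 * 1 + a = a + 2 by omega) (rfl : a + 2 * e = a + 2 * e)
      (show a + 2 + 2 * e = a + 2 * (e + 1) by omega) (show 2 + (a + 2 * e) = a + 2 * (e + 1) by omega)]

/-- **Left twist by an iterated Lefschetz operator**: `Lʳ_η ∘ T` is induced by a motivated class of codimension `e + r`
whenever `T : Hᵃ(X(ℂ)) → Hᵇ(W(ℂ))` is (`η ∈ N¹ H²(W(ℂ))` algebraic; induction on `r`).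
[cite: Andre1996Motifs, Prop. 2.1 (i) (p. 14) and §2.1 Corollaire (p. 15)] [cite: FultonYoungTableaux1997, Appendix B §B.1 (5)–(6)] -/
theorem lefschetzPowTo_comp_mem_map_corrAction_motivatedClasses (hW : IsSmoothProjective m W)
    (hX : IsSmoothProjective n X) {η : complexBetti W 2} (hη : η ∈ algebraicClasses W 1) (a b : ℕ) :
    ∀ (r : ℕ) {e e' b₂ : ℕ} (_ : e + r = e') (h12 : b + 2 * r = b₂) (hab : a + 2 * e = b + 2 * n)
      (hab₁ : a + 2 * e' = b₂ + 2 * n) {T : complexBetti X a →ₗ[ℂ] complexBetti W b}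
      (_ : T ∈ (motivatedClasses (m + n) (W ⊗ X) e).map (corrAction μ hW hX hab)),
      lefschetzPowTo η r b b₂ h12 ∘ₗ T ∈ (motivatedClasses (m + n) (W ⊗ X) e').map (corrAction μ hW hX hab₁)
  | 0, e, e', b₂, he, h12, hab, hab₁, T, hT => by
    obtain rfl : e = e' := by omega
    obtain rfl : b = b₂ := by omega
    rwa [lefschetzPowTo_zero_eq_id, LinearMap.id_comp]
  | r + 1, e, e', b₂, he, h12, hab, hab₁, T, hT => by
    -- `L^{r+1} ∘ T = L ∘ (Lʳ ∘ T)`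
    have hind := lefschetzPowTo_comp_mem_map_corrAction_motivatedClasses hW hX hη a b r
      (rfl : e + r = e + r) rfl hab (show a + 2 * (e + r) = b + 2 * r + 2 * n by omega) hT
    have hstep := lefschetzOperator_comp_mem_map_corrAction_motivatedClasses μ hW hX hη
      (show 2 + (b + 2 * r) = b₂ by omega) (show a + 2 * (e + r) = b + 2 * r + 2 * n by omega)
      (show a + 2 * (e + r + 1) = b₂ + 2 * n by omega) hind
    obtain rfl : e' = e + r + 1 := by omega
    have hcomp : lefschetzOperator η (show 2 + (b + 2 * r) = b₂ by omega) ∘ₗ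
        (lefschetzPowTo η r b (b + 2 * r) rfl ∘ₗ T) = lefschetzPowTo η (r + 1) b b₂ h12 ∘ₗ T := by
      refine LinearMap.ext fun x ↦ ?_
      rw [LinearMap.comp_apply, LinearMap.comp_apply, LinearMap.comp_apply,
        lefschetzPowTo_succ_apply η r b (b + 2 * r) b₂ rfl h12 (by omega)]
    rwa [hcomp] at hstep

/-! ## §3 Bookkeeping -/

/-- The operator of a motivated class lies in the image submodule (`Submodule.mem_map_of_mem`).
[cite: Andre1996Motifs, §2.1 Déf. 2 (p. 15)] -/
theorem corrAction_mem_map_corrAction_motivatedClasses (hW : IsSmoothProjective m W) (hX : IsSmoothProjective n X)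
    {e a b : ℕ} (hab : a + 2 * e = b + 2 * n) {γ : complexBetti (W ⊗ X) (2 * e)}
    (hγ : γ ∈ motivatedClasses (m + n) (W ⊗ X) e) :
    corrAction μ hW hX hab γ ∈ (motivatedClasses (m + n) (W ⊗ X) e).map (corrAction μ hW hX hab) :=
  Submodule.mem_map_of_mem hγ

/-- An operator that AGREES with one induced by a motivated class is induced by a motivated class (equality of
linear maps, e.g. checked on a spanning family). [cite: Andre1996Motifs, §2.1 Déf. 2 (p. 15)] -/
theorem mem_map_corrAction_motivatedClasses_of_eq (hW : IsSmoothProjective m W) (hX : IsSmoothProjective n X)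
    {e a b : ℕ} (hab : a + 2 * e = b + 2 * n) {S T : complexBetti X a →ₗ[ℂ] complexBetti W b}
    (hS : S ∈ (motivatedClasses (m + n) (W ⊗ X) e).map (corrAction μ hW hX hab)) (h : S = T) :
    T ∈ (motivatedClasses (m + n) (W ⊗ X) e).map (corrAction μ hW hX hab) :=
  h ▸ hS

end Summit.HodgeConjecture.HodgeConjecture.Theorems

end
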